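import Literature.AlgebraicGeometry.Frobenioids.PreFrobenioidDataToFunctor
import Literature.AlgebraicGeometry.Frobenioids.PreFrobenioidDataOfFunctor
import Literature.AlgebraicGeometry.Frobenioids.Frobenioid
import HarnessLib

/-!
# Frobenioids I, Definition 1.1 (iv) / 1.3: the round trip `F ↦ (operations of F) ↦ functor` is the
# identity ON THE NOSE

Mochizuki, *The geometry of Frobenioids I: the general theory*, Kyushu J. Math. **62** (2008)
293–400, §1, Definition 1.1 (iv), kurims text p. 20 [cite: MochizukiFrdI2008, Def. 1.1 (iv) p.20]: a
pre-Frobenioid structure on `C` is a functor `C → F_Φ`; the §3–§4 statement interface of the abc-iut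
cell (`PreFrobenioidData`, seat abc-iut-L1-t3) records instead its operations `(Base, Div, deg_Fr)` and
reads them back as a functor `S.toFunctor : C → F_{Φ_S}` (`PreFrobenioidDataToFunctor.lean`).

PROOF-ONLY file (theorems only). The companion equation `ofFunctor S.monFunctor S.toFunctor = S` is
`PreFrobenioidData.ofFunctor_toFunctor` (by `rfl`). Here the OTHER round trip: for a functor
`F : C ⥤ F_Φ`, the divisor-monoid functor of `ofFunctor Φ F` is `Φ` and the functor read back from the
operations of `F` is `F` itself — both DEFINITIONALLY (`rfl`; structure eta for `CommMonCat`, `Opposite`,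
`ElemFrobenioid` and its hom-structure). Consequently every predicate of the tree transfers along the
round trip by `Iff.rfl`; in particular "`F` is a (pre-)Frobenioid" iff "`(ofFunctor Φ F).toFunctor` is",
which is the shape in which several sub-DAG slots of the cell take their Frobenioid hypotheses (e.g.
`hBi : IsFrobenioid (biratData hF hsq).ops.toFunctor` in `Prop55Sub.lean`, `PerfectionBiratCommute.lean`):
such a slot is fed DIRECTLY by a proof of `IsFrobenioid (Birat.toElemZero hF hsq)` resp.
`IsFrobenioid F`. Seat abc-iut-L6-t20 (abc-iut cell). No statement of the paper is involved beyond
Def. 1.1 (iv); nothing here concerns the disputed parts of IUT.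
-/

namespace Literature.AlgebraicGeometry.Frobenioids

open CategoryTheory Opposite

universe w v v' u u'

namespace PreFrobenioidData

variable {D : Type u} [Category.{v} D] {Φ : Dᵒᵖ ⥤ CommMonCat.{w}}
  {C : Type u'} [Category.{v'} C] (F : C ⥤ ElemFrobenioid Φ)

/-- The divisor-monoid functor of the operations of `F : C ⥤ F_Φ` is `Φ`, definitionally.
[cite: MochizukiFrdI2008, Def. 1.1 (iv) p.20] -/
theorem monFunctor_ofFunctor : (ofFunctor Φ F).monFunctor = Φ := rfl

/-- **Round trip**: the functor read back from the operations of `F : C ⥤ F_Φ` is `F`, definitionally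
(the two sides live over the definitionally equal divisor-monoid functors `(ofFunctor Φ F).monFunctor`
and `Φ`, so the equation is stated heterogeneously). [cite: MochizukiFrdI2008, Def. 1.1 (iv) p.20] -/
theorem toFunctor_ofFunctor_heq : HEq (ofFunctor Φ F).toFunctor F := HEq.rfl

end PreFrobenioidData

namespace PreFrobenioid

variable {D : Type u} [Category.{v} D] {Φ : Dᵒᵖ ⥤ CommMonCat.{w}}
  {C : Type u'} [Category.{v'} C] (F : C ⥤ ElemFrobenioid Φ)

/-- `F` is a pre-Frobenioid iff the round-trip functor of its operations is (definitionally the same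
proposition). [cite: MochizukiFrdI2008, Def. 1.1 (iv) p.20] -/
theorem isPreFrobenioid_toFunctor_ofFunctor_iff :
    IsPreFrobenioid (PreFrobenioidData.ofFunctor Φ F).monFunctor
        (PreFrobenioidData.ofFunctor Φ F).toFunctor ↔ IsPreFrobenioid Φ F :=
  Iff.rfl

/-- **`F` is a Frobenioid iff the round-trip functor of its operations is** (definitionally the same
proposition: all of Def. 1.3 (i)–(vii) transfers on the nose). [cite: MochizukiFrdI2008, Def. 1.3 p.24] -/
theorem isFrobenioid_toFunctor_ofFunctor_iff :
    IsFrobenioid (PreFrobenioidData.ofFunctor Φ F).toFunctor ↔ IsFrobenioid F :=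
  Iff.rfl

variable {F} in
/-- A Frobenioid structure `F` makes the round-trip functor of its operations a Frobenioid (the form in
which sub-DAG slots of the cell take the hypothesis, e.g. `IsFrobenioid (biratData hF hsq).ops.toFunctor`).
[cite: MochizukiFrdI2008, Def. 1.3 p.24] -/
theorem IsFrobenioid.toFunctor_ofFunctor (hF : IsFrobenioid F) :
    IsFrobenioid (PreFrobenioidData.ofFunctor Φ F).toFunctor :=
  hF

variable {F} in
/-- Conversely, a Frobenioid structure on the round-trip functor is one on `F`.
[cite: MochizukiFrdI2008, Def. 1.3 p.24] -/
theorem IsFrobenioid.of_toFunctor_ofFunctor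
    (h : IsFrobenioid (PreFrobenioidData.ofFunctor Φ F).toFunctor) : IsFrobenioid F :=
  h

end PreFrobenioid

end Literature.AlgebraicGeometry.Frobenioids
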